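import Literature.Probability.RandomPlanarGeometry.SAWCountZdSingletonAxisIdentity
import Literature.Probability.RandomPlanarGeometry.SAWCountZdNoSingletonEngine
import Literature.Probability.RandomPlanarGeometry.SAWCountSmallZd
import Literature.Probability.RandomPlanarGeometry.SAWPulledLargeForceExpansionZdTenthOrder
import Literature.Probability.RandomPlanarGeometry.SAWPulledLargeForceExpansionZdCostPolynomial
import Literature.Probability.RandomPlanarGeometry.SAWIrreducibleBridgeSpanOne
import HarnessLib

/-!
# «SINGLETON-AXIS ASSEMBLY»: from the identity, the no-singleton engine and the tree's `c_ℓ(ℤ^e)`, `ℓ ≤ 10`, to `c_n(ℤ^d)` in every dimension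

Topic `Literature/Probability/RandomPlanarGeometry` (joins `SAWCountZdSingletonAxisIdentity.lean` (list model: ★★★ `Word.count_eq_card_nsWords_add_sum`,
`c_n = A_n + Σ_r (−1)^{r+1} 2^r d^{(r)} Σ_ℓ Π c_{ℓ_j}(ℤ^{d−r})`) and `SAWCountZdNoSingletonEngine.lean` (function model: ★★★ `card_isSAW_noSingF_of_fastAS`, the
census `A_n(d)` from one kernel value); uses the tree's closed forms `count_one … count_ten` (`…ZdFirstOrder`, `SAWCountSmallZd`, `…ZdNineStep`,
`…ZdTenStep`, `…ZdTenthOrder`), the binomial expansion `costCoeffZd_eq_sum_choose_mul` (`…ZdCostPolynomial`) and `costCoeffZd_self_succ`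
(`SAWIrreducibleBridgeSpanOne`: `N_{n,n+1} = c_n`)).

* §1 ★ `card_nsWords_eq_card_filter`: the two models count the same words (`countP_ofFn`, `noSingF_iff_card`, `noSingleton_ofFn_iff`);
* §2 `countTab` — the table `c_ℓ(ℤ^e)`, `ℓ ≤ 10`, as ONE computable function, ★ `count_eq_countTab`;
* §3 `rhsA` — the right-hand side of the identity with the table plugged in (computable once the census `A` is), ★★ `count_eq_rhsA` (`n ≤ 11`);
* §4 ★ `eq_of_sum_choose_eq` (binomial-basis coefficients are pinned by the values at `d ≤ n`) and ★★★ `count_eq_sum_choose_of_le`: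
  **`c_n(ℤ^d)` for EVERY `d` from its values at `d = 0, …, n`** (it is `Σ_{u ≤ n} C(d,u) F(u)` by `costCoeffZd_eq_sum_choose_mul`);
* §5 END-TO-END SELF-TEST at `n = 6`: ★ `count_six_eq_sum_choose` — `c_6(ℤ^d) = Σ_{u ≤ 6} C(d,u) · (0, 2, 776, 14592, 64128, 96000, 46080)_u` for every `d`,
  the values at `d ≤ 6` being the KERNEL-EVALUATED right-hand side of the identity (census `a_6 = (1, 87, 63)` of the engine's self-test, table `c_ℓ`,
  `ℓ ≤ 5`) — the whole chain identity → engine → table → interpolation checked against the classical `c_6` (cf. `count_six_eq`).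
The sequel «COUNT-ELEVEN» runs §3–§4 at `n = 11` on the kernel cells of `A_{11}`.
[cite: MadrasSlade1993, §1.1; Definition 1.1.1; Appendix C, Table C.1]
The definitions `countTab`, `rhsA`, `A6f`, `G6` are this file's tool notions (not notions in print).  No number is taken from print beyond the tree's `c_ℓ`.

Provenance: lane «pcv-sawmu», a-p3 g23 (2026-08-27).
-/

open Finset
open scoped BigOperators
open Literature.Probability.LatticeModels
open Literature.Probability.RandomPlanarGeometry.SAW

namespace Literature.Probability.RandomPlanarGeometry.SAW.Zd

namespace WordTypes

/-! ### §1 The list model meets the function model: `#nsWords d L = #{u : Word L d | self-avoiding, no singleton axis}` -/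

/-- `countP` over `List.ofFn` is a cardinality over `Fin n`. [cite: MadrasSlade1993, Definition 1.1.1] -/
theorem countP_ofFn {α : Type*} (p : α → Bool) : ∀ {n : ℕ} (f : Fin n → α),
    (List.ofFn f).countP p = (Finset.univ.filter fun i : Fin n => p (f i) = true).card := by
  intro n
  induction n with
  | zero => intro f; simp
  | succ n ih =>
    intro f
    rw [List.ofFn_succ, List.countP_cons, ih, Fin.card_filter_univ_succ' (fun i => p (f i) = true)]
    by_cases h0 : p (f 0) = true
    · simp only [if_pos h0]; omega
    · simp only [if_neg h0]; omega

/-- No singleton axis, position form versus axis-count form (any alphabet of axes). [cite: MadrasSlade1993, Definition 1.1.1] -/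
theorem noSingF_iff_card {L d : ℕ} (u : Word L d) :
    NoSingF u ↔ ∀ a : Fin d, (Finset.univ.filter fun p : Fin L => (u p).1 = a).card ≠ 1 := by
  constructor
  · intro h a ha
    rw [Finset.card_eq_one] at ha
    obtain ⟨p, hp⟩ := ha
    have hpm : p ∈ Finset.univ.filter fun q : Fin L => (u q).1 = a := by rw [hp]; exact Finset.mem_singleton_self p
    obtain ⟨q, hqp, hq⟩ := h p
    have hqm : q ∈ Finset.univ.filter fun q : Fin L => (u q).1 = a := by
      rw [Finset.mem_filter] at hpm ⊢; exact ⟨Finset.mem_univ _, by rw [hq]; exact hpm.2⟩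
    rw [hp, Finset.mem_singleton] at hqm
    exact hqp hqm
  · intro h p
    by_contra hne
    push Not at hne
    apply h (u p).1
    rw [Finset.card_eq_one]
    refine ⟨p, Finset.eq_singleton_iff_unique_mem.2 ⟨by simp, fun q hq => ?_⟩⟩
    rw [Finset.mem_filter] at hq
    by_contra hqp
    exact hne q hqp hq.2

/-- The list-model predicate `Word.NoSingleton (List.ofFn u)` is `NoSingF u`. [cite: MadrasSlade1993, Definition 1.1.1] -/
theorem noSingleton_ofFn_iff {L d : ℕ} (u : Word L d) : Word.NoSingleton (List.ofFn u) ↔ NoSingF u := by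
  rw [noSingF_iff_card]
  unfold Word.NoSingleton Word.axCount
  refine forall_congr' fun a => ?_
  rw [countP_ofFn]
  simp only [decide_eq_true_eq]

open Classical in
/-- ★ THE TWO MODELS COUNT THE SAME WORDS: `#nsWords d L = #{u : Word L d | self-avoiding ∧ no singleton axis}`. [cite: MadrasSlade1993, Definition 1.1.1] -/
theorem card_nsWords_eq_card_filter (d L : ℕ) :
    (Word.nsWords d L).card = (Finset.univ.filter fun u : Word L d => Percolation.IsSAW u ∧ NoSingF u).card := by
  rw [Word.nsWords, Word.sawWords_eq_image, Finset.filter_image, Finset.card_image_of_injective _ List.ofFn_injective]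
  congr 1
  ext u
  simp only [Finset.mem_filter, Percolation.mem_sawWords, Finset.mem_univ, true_and, noSingleton_ofFn_iff]


/-! ### §2 The tree's counts `c_ℓ(ℤ^e)`, `ℓ ≤ 10`, as one computable table -/

/-- The closed forms of `c_ℓ(ℤ^e)` for `ℓ ≤ 10` (the tree's `count_one … count_ten`), as a computable function (truncated subtractions exactly as in
those statements; `0` beyond `ℓ = 10`). [cite: MadrasSlade1993, §1.1] -/
def countTab (e : ℕ) : ℕ → ℕ
  | 0 => 1
  | 1 => 2 * e
  | 2 => 2 * e * (2 * e - 1)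
  | 3 => 2 * e * (2 * e - 1) ^ 2
  | 4 => 2 * e * (2 * e - 1) ^ 3 - 2 * e * (2 * e - 2)
  | 5 => 2 * e * (2 * e - 1) ^ 4 - 2 * e * (2 * e - 2) * (4 * e - 3)
  | 6 => 64 * e ^ 6 + 112 * e ^ 4 + 20 * e ^ 2 - 160 * e ^ 5 - 34 * e
  | 7 => 128 * e ^ 7 + 352 * e ^ 5 + 192 * e ^ 3 + 166 * e - (384 * e ^ 6 + 80 * e ^ 4 + 372 * e ^ 2)
  | 8 => 256 * e ^ 8 + 1024 * e ^ 6 + 320 * e ^ 4 + 424 * e ^ 3 + 1414 * e - 896 * e ^ 7 - 416 * e ^ 5 - 2124 * e ^ 2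
  | 9 => 512 * e ^ 9 + 2816 * e ^ 7 + 704 * e ^ 5 + 4096 * e ^ 4 + 16756 * e ^ 2 - 2048 * e ^ 8 - 1600 * e ^ 6 - 15376 * e ^ 3 - 5858 * e
  | 10 => 1024 * e ^ 10 + 7424 * e ^ 8 + 2112 * e ^ 6 + 7008 * e ^ 5 + 640 * e ^ 4 + 167544 * e ^ 2 -
      (4608 * e ^ 9 + 5376 * e ^ 7 + 90984 * e ^ 3 + 84782 * e)
  | _ => 0

/-- ★ `c_ℓ(ℤ^e) = countTab e ℓ` for `ℓ ≤ 10` (every dimension `e`). [cite: MadrasSlade1993, §1.1; Appendix C, Table C.1] -/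
theorem count_eq_countTab (e ℓ : ℕ) (h : ℓ ≤ 10) : count e ℓ = countTab e ℓ := by
  interval_cases ℓ
  · rw [count_zero]; rfl
  · rw [← costCoeffZd_self_succ, costCoeffZd_one_two]; rfl
  · rw [← costCoeffZd_self_succ, costCoeffZd_two_three]; rfl
  · rw [count_three_eq]; rfl
  · rw [count_four_eq]; rfl
  · rw [count_five_eq]; rfl
  · rw [count_six_eq]; rfl
  · have h7 := count_seven_add e; rw [countTab]; omega
  · rw [count_eight]; rfl
  · rw [count_nine]; rfl
  · rw [count_ten]; rfl

/-! ### §3 The identity with the table: `c_n(ℤ^d)` as an explicit computable expression in the no-singleton census -/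

/-- The right-hand side of the singleton-axis identity for `n ≤ 11` with the census term supplied as a function `A`. [cite: MadrasSlade1993, §1.1] -/
def rhsA (A : ℕ → ℤ) (n d : ℕ) : ℤ :=
  A d + ∑ r ∈ Finset.Ico 1 (n + 1), (-1 : ℤ) ^ (r + 1) *
    (2 ^ r * d.descFactorial r * ∑ ℓ ∈ Finset.Nat.antidiagonalTuple (r + 1) (n - r), ∏ j, countTab (d - r) (ℓ j) : ℕ)

/-- A part of a composition is at most the total. [cite: MadrasSlade1993, §1.1] -/
theorem le_of_mem_antidiagonalTuple {k s : ℕ} {ℓ : Fin k → ℕ} (h : ℓ ∈ Finset.Nat.antidiagonalTuple k s) (j : Fin k) : ℓ j ≤ s := by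
  rw [Finset.Nat.mem_antidiagonalTuple] at h
  rw [← h]
  exact Finset.single_le_sum (fun i _ => Nat.zero_le (ℓ i)) (Finset.mem_univ j)

/-- ★★ `c_n(ℤ^d) = rhsA A n d` whenever `A` is the no-singleton census and `n ≤ 11` (all `c_ℓ` on the right have `ℓ ≤ 10`). [cite: MadrasSlade1993, §1.1] -/
theorem count_eq_rhsA {n : ℕ} (hn : n ≤ 11) (A : ℕ → ℤ) (hA : ∀ d, ((Word.nsWords d n).card : ℤ) = A d) (d : ℕ) :
    (count d n : ℤ) = rhsA A n d := by
  rw [Word.count_eq_card_nsWords_add_sum, hA, rhsA]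
  congr 1
  refine Finset.sum_congr rfl fun r hr => ?_
  rw [Finset.mem_Ico] at hr
  congr 2
  congr 1
  rw [Word.blockSum]
  refine Finset.sum_congr rfl fun ℓ hℓ => Finset.prod_congr rfl fun j _ => ?_
  rw [count_eq_countTab _ _ (le_trans (le_of_mem_antidiagonalTuple hℓ j) (by omega))]

/-! ### §4 A polynomial of degree `≤ n` in the dimension is pinned by its values at `d = 0, …, n` -/

/-- Two binomial-basis expansions that agree at `d = 0, …, n` have the same coefficients. [cite: MadrasSlade1993, §1.1] -/
theorem eq_of_sum_choose_eq {n : ℕ} {F G : ℕ → ℕ}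
    (h : ∀ d, d ≤ n → ∑ u ∈ Finset.range (n + 1), d.choose u * F u = ∑ u ∈ Finset.range (n + 1), d.choose u * G u) :
    ∀ u, u ≤ n → F u = G u := by
  intro u
  induction u using Nat.strong_induction_on with
  | _ u ih =>
    intro hu
    have hsplit : ∀ H : ℕ → ℕ, ∑ v ∈ Finset.range (n + 1), u.choose v * H v = H u + ∑ v ∈ Finset.range u, u.choose v * H v := by
      intro H
      rw [← Finset.sum_range_add_sum_Ico _ (show u + 1 ≤ n + 1 by omega), Finset.sum_range_succ, Nat.choose_self, one_mul]
      rw [Finset.sum_eq_zero (s := Finset.Ico (u + 1) (n + 1)) (fun v hv => by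
        rw [Finset.mem_Ico] at hv; rw [Nat.choose_eq_zero_of_lt (by omega), zero_mul]), add_zero, add_comm]
    have h1 := h u hu
    rw [hsplit F, hsplit G, Finset.sum_congr rfl (fun v hv => by rw [ih v (Finset.mem_range.1 hv) (by
      have := Finset.mem_range.1 hv; omega)] : ∀ v ∈ Finset.range u, u.choose v * F v = u.choose v * G v)] at h1
    omega

/-- ★★★ **`c_n(ℤ^d)` IN EVERY DIMENSION FROM ITS VALUES AT `d ≤ n`**: `c_n(ℤ^d)` is a binomial-basis polynomial of degree `≤ n` in `d`
(`costCoeffZd_eq_sum_choose_mul`), so if `c_n(ℤ^d) = Σ_{u ≤ n} C(d,u) G(u)` for `d = 0, …, n` then for every `d`. [cite: MadrasSlade1993, §1.1] -/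
theorem count_eq_sum_choose_of_le (n : ℕ) (G : ℕ → ℕ) (hG : ∀ d, d ≤ n → count d n = ∑ u ∈ Finset.range (n + 1), d.choose u * G u)
    (d : ℕ) : count d n = ∑ u ∈ Finset.range (n + 1), d.choose u * G u := by
  classical
  -- the binomial expansion of `c_n(ℤ^d) = N_{n,n+1}(ℤ^{d+1})`
  have hF : ∀ d, count d n = ∑ u ∈ Finset.range (n + 1), d.choose u *
      ((irreducibleBridges (u + 1) (n + 1)).filter fun (ω : ℕ → Site (u + 1)) => costZd u (n + 1) ω = n ∧
        ∀ a : Fin (u + 1), a ≠ 0 → ∃ i ≤ n + 1, ω i a ≠ (0 : ℤ)).card := fun d => by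
    rw [← costCoeffZd_self_succ, costCoeffZd_eq_sum_choose_mul]
  have key : ∀ d, d ≤ n → ∑ u ∈ Finset.range (n + 1), d.choose u *
      ((irreducibleBridges (u + 1) (n + 1)).filter fun (ω : ℕ → Site (u + 1)) => costZd u (n + 1) ω = n ∧
        ∀ a : Fin (u + 1), a ≠ 0 → ∃ i ≤ n + 1, ω i a ≠ (0 : ℤ)).card = ∑ u ∈ Finset.range (n + 1), d.choose u * G u :=
    fun d hd => (hF d).symm.trans (hG d hd)
  have hFG := eq_of_sum_choose_eq key
  rw [hF d]
  exact Finset.sum_congr rfl fun u hu => by rw [hFG u (Nat.le_of_lt_succ (Finset.mem_range.1 hu))]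


/-! ### §5 END-TO-END SELF-TEST at `n = 6`: the identity + the kernel census `a_6 = (1, 87, 63)` + the table `c_ℓ`, `ℓ ≤ 5`, re-derive `c_6(ℤ^d)` for every `d` -/

/-- The no-singleton census at `n = 6` as a function of the dimension (from the engine's kernel self-test). [cite: MadrasSlade1993, §1.1] -/
def A6f (d : ℕ) : ℤ := ((2 * d.descFactorial 1 + 348 * d.descFactorial 2 + 504 * d.descFactorial 3 : ℕ) : ℤ)

/-- `#nsWords d 6 = A6f d`. [cite: MadrasSlade1993, §1.1] -/
theorem card_nsWords_six (d : ℕ) : ((Word.nsWords d 6).card : ℤ) = A6f d := by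
  rw [card_nsWords_eq_card_filter, card_isSAW_noSingF_six]; rfl

/-- The binomial-basis coefficients of `c_6(ℤ^d)`: `u! · 2^u · (1, 97, 304, 167, 25, 1)`. [cite: MadrasSlade1993, §1.1] -/
def G6 : ℕ → ℕ
  | 1 => 2 | 2 => 776 | 3 => 14592 | 4 => 64128 | 5 => 96000 | 6 => 46080 | _ => 0

/-- ★ END-TO-END: `c_6(ℤ^d) = Σ_{u ≤ 6} C(d,u) G6(u)` for EVERY `d` — at `d ≤ 6` the right-hand side of the identity is EVALUATED (kernel arithmetic on the
census `a_6`, the table `c_ℓ(ℤ^e)`, `ℓ ≤ 5`), beyond by `count_eq_sum_choose_of_le`. [cite: MadrasSlade1993, §1.1; Appendix C, Table C.1] -/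
theorem count_six_eq_sum_choose (d : ℕ) : count d 6 = ∑ u ∈ Finset.range 7, d.choose u * G6 u := by
  refine count_eq_sum_choose_of_le 6 G6 (fun d hd => ?_) d
  have h := count_eq_rhsA (by norm_num) A6f card_nsWords_six d
  rw [← Nat.cast_inj (R := ℤ), h]
  interval_cases d <;> decide

end WordTypes

end Literature.Probability.RandomPlanarGeometry.SAW.Zd
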